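import Literature.Barriers.SmoothPoincare4.StableInvariantsBlindParity
import Literature.Topology.FourManifolds.TwistedSurgeryOddExists
import HarnessLib

/-!
# `StableBarrierFour` from `Θ₄ = 0` alone

Sibling proof file of `Literature/Barriers/SmoothPoincare4/StableInvariantsBlind.lean` (barrier
`Literature.Barriers.SmoothPoincare4.StableBarrierFour`: no invariant of the `S² × S²`-stable
diffeomorphism type — in particular no semisimple 4-dimensional TFT, Reutter 2023 Thm. 1,
Reutter–Schommer-Pries 2022 Thm. A — distinguishes a homotopy 4-sphere from `S⁴`).

The barrier is Wall's Theorem 3 for the pair `(Σ, S⁴)` plus `Θ₄ = 0` (Kervaire–Milnor 1963):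
`Σ # k(S² × S²) ≅ # k(S² × S²)`.  `StableInvariantsBlindParity.lean` reduced the input from
Wall's theorem to the oddness `hodd` of the twisted surgery (the ends `Σ`, `S⁴` being even);
`hodd` is now a theorem
(`Literature.Topology.FourManifolds.forall_exists_isOdd_intersectionForm_twistSurgered`: the
twisted surgery contains `ℂℙ² ∖ {pt}` and is simply connected), so the barrier follows from
`Θ₄ = 0` ALONE — each statement below is the corresponding `…_of_isOdd_twist` theorem of
`StableInvariantsBlindParity.lean` applied to the discharged hypothesis:

* `exists_isStabilization_sphere_of_homotopySphere_four_of_thetaFour` — every homotopy 4-sphere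
  has a common stabilisation with `S⁴`, GIVEN `Θ₄ = 0`
  (`Literature.Topology.FourManifolds.isHCobordant_sphere_of_homotopySphere_four`);
* **`stableBarrierFour_of_thetaFour`** — `StableBarrierFour` GIVEN `Θ₄ = 0`.

No named fact is introduced; the one hypothesis is the tree's named fact `Θ₄ = 0`
(Kervaire–Milnor 1963, Thm. 1.1 with the table `|Θ₄| = 1`), on whose discharge
`StableBarrierFour_holds` now solely depends.

## References

* R. C. Kirby, *The Topology of 4-Manifolds*, LNM 1374 (1989), Ch. X pp. 55–56. [Kirby1989]
* C. T. C. Wall, *On simply-connected 4-manifolds*, J. London Math. Soc. 39 (1964), Thm. 3.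
  [WallJLMS1964]
* M. Kervaire, J. Milnor, *Groups of homotopy spheres I*, Ann. of Math. 77 (1963), Thm. 1.1.
  [KervaireMilnorAnnals1963]
* D. Reutter, *Semisimple 4-dimensional topological field theories cannot detect exotic smooth
  structure*, J. Topol. 16 (2023), Thm. 1. [Reutter2023SemisimpleTFT]
* D. Reutter, C. Schommer-Pries, *Semisimple field theories detect stable diffeomorphism*,
  arXiv:2206.10031 (2022), Thm. A. [ReutterSchommerPries2022]
-/

noncomputable section

open scoped Manifold ContDiff
open Set Literature.Topology.FourManifolds Literature.AlgebraicTopology.SingularHomology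

namespace Literature.Barriers.SmoothPoincare4

universe u

/-- **Every homotopy 4-sphere is stably diffeomorphic to `S⁴`, GIVEN `Θ₄ = 0`** (Wall 1964, Thm. 3 with Kervaire–Milnor 1963, Thm. 1.1): the h-cobordism
`Σ ∼ S⁴` of `Θ₄ = 0` (`isHCobordant_sphere_of_homotopySphere_four`) has as middle level a common
`k`-fold stabilisation of `Σ` and `S⁴` (Wall's Theorem 3 for even ends, the oddness of the
twisted surgery being the theorem `forall_exists_isOdd_intersectionForm_twistSurgered`; the ends
are even for want of classes in `H²/T`; `π₁(S⁴) = 1` is `simplyConnectedSpace_sphere_four_holds`).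
[cite: WallJLMS1964, Thm. 3] [cite: KervaireMilnorAnnals1963, Thm. 1.1] [cite: Kirby1989, Ch. X pp. 55–56] -/
theorem exists_isStabilization_sphere_of_homotopySphere_four_of_thetaFour
    (hΘ : isHCobordant_sphere_of_homotopySphere_four)
    (S : HomotopySphere 4) :
    ∃ (k : ℕ) (P : Type) (_ : TopologicalSpace P) (_ : T2Space P)
      (_ : SecondCountableTopology P) (_ : ChartedSpace (EuclideanSpace ℝ (Fin 4)) P) (_ : CompactSpace P)
      (_ : IsManifold (𝓡 4) ∞ P),
      IsStabilization k S.carrier P ∧ IsStabilization k (Metric.sphere (0 : EuclideanSpace ℝ (Fin 5)) 1) P :=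
  exists_isStabilization_sphere_of_homotopySphere_four_of_thetaFour_of_isOdd_twist (hodd := forall_exists_isOdd_intersectionForm_twistSurgered) hΘ S

/-- **`StableBarrierFour` GIVEN `Θ₄ = 0` alone**: a stable
invariant `I` takes the value `I S⁴` on every homotopy 4-sphere `Σ`, since some closed smooth
`P` is a `k`-fold stabilisation of both
(`exists_isStabilization_sphere_of_homotopySphere_four_of_thetaFour`).  Relative to
`stableBarrierFour_of_wall` (Wall's Thm. 3 + `Θ₄ = 0` + `π₁(S⁴) = 1`) the input from
Wall's theorem is now PROVED (for the even ends that occur): `Θ₄ = 0`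
(`Literature.Topology.FourManifolds.isHCobordant_sphere_of_homotopySphere_four`, Kervaire–Milnor
1963, Thm. 1.1) is the only named fact behind the barrier. [cite: WallJLMS1964, Thm. 3] [cite: KervaireMilnorAnnals1963, Thm. 1.1] [cite: Reutter2023SemisimpleTFT, §1.1 Thm. 1 and Cor. 2] -/
theorem stableBarrierFour_of_thetaFour
    (hΘ : isHCobordant_sphere_of_homotopySphere_four) :
    StableBarrierFour.{u} :=
  stableBarrierFour_of_thetaFour_of_isOdd_twist (hodd := forall_exists_isOdd_intersectionForm_twistSurgered) hΘ

end Literature.Barriers.SmoothPoincare4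

end
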